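import Mathlib
import Literature.RepresentationTheory.CompactGroups.CircleCharacters
import HarnessLib

/-!
# A finite-dimensional continuous representation of `U(1)` is the direct sum of its integer weight spaces

Bröcker–tom Dieck, *Representations of Compact Lie Groups* (GTM 98, 1985), Ch. II (8.1)–(8.2)
[BrockerTomDieck1985]: "The irreducible complex representations of `S¹` are given by the characters
`z ↦ z^m`, `m ∈ ℤ`" (8.1); for a torus `T` and a complex `T`-module `V` the weight space of a character `ϑ`
is `V(ϑ) = {v ∈ V | x v = ϑ(x) · v for all x ∈ T}` (8.2), "and it follows from (1.14) that every complex
`T`-module is the direct sum of its weight spaces".  This file proves the case `T = U(1)` = Mathlib's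
`Circle`, for a representation `ρ : Circle →* Module.End ℂ W` on a finite-dimensional complex vector space
`W` carrying any Hausdorff vector-space topology in which the orbit maps `u ↦ ρ u x` are continuous:

* `weightSpace ρ k = {x | ∀ u, ρ u x = u ^ k • x}` (`k : ℤ`), `mem_weightSpace_iff`;
* `iSupIndep_weightSpace` : the weight spaces are INDEPENDENT (purely algebraic: no topology, no
  finite-dimensionality — joint eigenspaces of a commuting family for distinct eigencharacters,
  Mathlib `Module.End.independent_iInf_maxGenEigenspace_of_forall_mapsTo`);
* `iSup_weightSpace_eq_top` : they SPAN `W` — (8.1) + (1.14) for `S¹`, kernel-proved as follows: the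
  torsion of `U(1)` is dense (`dense_isOfFinOrder`) and acts by a commuting family of semisimple operators
  (`isSemisimple_of_pow_eq_one`: `X^n − 1` is separable over `ℂ`), so `W` is spanned by joint eigenvectors
  of the torsion (Mathlib `iSup_iInf_maxGenEigenspace_eq_top_of_iSup_maxGenEigenspace_eq_top_of_commute`); the
  line through such a vector is closed, hence stable under all of `U(1)` by density, and the resulting
  continuous character `U(1) → ℂˣ` is `u ↦ u^k` by the tree's
  `CircleChar.existsUnique_zpow_complex` (`CircleCharacters`, loc. cit. (8.1));
* `isInternal_weightSpace` : `W = ⊕_{k ∈ ℤ} W_k` (`DirectSum.IsInternal`), and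
  `finite_weightSpace_ne_bot` : only finitely many weights occur.

## Mathlib / tree

Mathlib has weight spaces of Lie-algebra modules (`LieModule.weightSpace`), the simultaneous
(generalised) eigenspace machinery used here, and `Circle` with its characters into itself, but not the
weight decomposition of `U(1)`-modules; the tree's `CircleCharacters` classifies the continuous characters
(`χ = z ↦ z^n`) and proves the one-line case `existsUnique_lineExponent`; `TorusCharacters` /
`LieAlgebraWeights` (`Literature.NumberTheory.Automorphic`) treat ALGEBRAIC tori acting on `𝔤𝔩ₙ` by `Ad`.
No declaration is duplicated (`lean search 'iSup_weightSpace_eq_top|CircleWeights'`: no hit outside this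
file and the cell package it supersedes).

## Provenance

Staged by the pub-hodgecm formalisation cell (DAG-node prover #02 lineage) under the LEAN-IN-TREE rule; it
supersedes, re-sourced to print and with the independence half added, §1 `HodgeCM.PerL34.CircleWeights` of
the cell's standalone package file `HodgeCM/PerL34/ArchAWeilFinite.lean` (namespace
`HodgeCM.PerL34.CircleWeights` ↦ `Literature.RepresentationTheory.CompactGroups.CircleWeights`).  Nothing
here is a claim of the manuscripts that cell adjudicates.
-/

noncomputable section

open Module Module.End Polynomial Topology

namespace Literature.RepresentationTheory.CompactGroups

namespace CircleWeights

/-- **The torsion of `U(1)` (the roots of unity) is dense.** [folklore] -/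
theorem dense_isOfFinOrder : Dense {u : Circle | IsOfFinOrder u} := by
  have h1 : DenseRange (fun r : ℝ => Circle.exp (2 * Real.pi * r)) := by
    refine Function.Surjective.denseRange fun z => ?_
    obtain ⟨x, rfl⟩ := Circle.exp_surjective z
    exact ⟨x / (2 * Real.pi), by rw [mul_div_cancel₀ _ (by positivity)]⟩
  have hd : DenseRange (fun q : ℚ => Circle.exp (2 * Real.pi * (q : ℝ))) :=
    h1.comp Rat.denseRange_cast (Circle.exp.continuous.comp (continuous_const.mul continuous_id))
  refine Dense.mono ?_ hd
  rintro _ ⟨q, rfl⟩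
  refine isOfFinOrder_iff_pow_eq_one.mpr ⟨q.den, q.den_pos, ?_⟩
  have hq : (q.den : ℝ) * (q : ℝ) = (q.num : ℝ) := by exact_mod_cast Rat.den_mul_eq_num q
  rw [← Circle.exp_natCast_mul, ← mul_assoc, mul_comm (q.den : ℝ) (2 * Real.pi), mul_assoc, hq,
    Circle.exp_two_pi_mul_int]

variable {W : Type*} [AddCommGroup W] [Module ℂ W]

/-- An endomorphism of finite order of a complex vector space is semisimple (`X^n − 1` is separable, hence
squarefree, over `ℂ`; Maschke for a cyclic group). [folklore] -/
theorem isSemisimple_of_pow_eq_one {f : Module.End ℂ W} {n : ℕ} (hn : 0 < n) (hf : f ^ n = 1) :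
    f.IsSemisimple := by
  refine Module.End.isSemisimple_of_squarefree_aeval_eq_zero (p := X ^ n - C 1) ?_ ?_
  · exact (Polynomial.separable_X_pow_sub_C (1 : ℂ) (Nat.cast_ne_zero.mpr hn.ne') one_ne_zero).squarefree
  · rw [map_sub, map_pow, aeval_X, aeval_C, map_one, hf, sub_self]

/-- The **weight space** of weight `k ∈ ℤ` of a `U(1)`-action `ρ`: `W_k = {x | ∀ u, ρ u x = u^k • x}`, the
space `V(ϑ)` of Bröcker–tom Dieck II (8.2) for the character `ϑ = (u ↦ u^k)` of (8.1).
[cite: BrockerTomDieck1985, II (8.2)] -/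
def weightSpace (ρ : Circle →* Module.End ℂ W) (k : ℤ) : Submodule ℂ W :=
  ⨅ u : Circle, eigenspace (ρ u) ((u : ℂ) ^ k)

/-- Unfolding of `weightSpace`. [folklore] -/
theorem mem_weightSpace_iff (ρ : Circle →* Module.End ℂ W) (k : ℤ) (x : W) :
    x ∈ weightSpace ρ k ↔ ∀ u : Circle, ρ u x = ((u : ℂ) ^ k) • x := by
  simp only [weightSpace, Submodule.mem_iInf, mem_eigenspace_iff]

/-- The characters `u ↦ u^k`, `k ∈ ℤ`, of `U(1)` are pairwise distinct as functions `U(1) → ℂ`.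
[cite: BrockerTomDieck1985, II (8.1)] -/
theorem zpow_coe_injective : Function.Injective fun k : ℤ => fun u : Circle => ((u : ℂ) ^ k) := by
  intro k l h
  refine CircleChar.zpow_injective' fun z => ?_
  have hz := congr_fun h z
  simp only at hz
  ext
  rw [Circle.coe_zpow, Circle.coe_zpow, hz]

/-- **The weight spaces of a `U(1)`-action are independent** (their sum is direct) — no topology and no
finite-dimensionality needed. [cite: BrockerTomDieck1985, II (8.2)] -/
theorem iSupIndep_weightSpace (ρ : Circle →* Module.End ℂ W) : iSupIndep (weightSpace ρ) := by
  let f : Circle → Module.End ℂ W := fun u => ρ u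
  have hcomm : ∀ u v : Circle, Commute (f u) (f v) := fun u v => by
    change ρ u * ρ v = ρ v * ρ u
    rw [← map_mul, ← map_mul, mul_comm]
  have hind := Module.End.independent_iInf_maxGenEigenspace_of_forall_mapsTo f
    (fun i j φ => Module.End.mapsTo_maxGenEigenspace_of_comm (hcomm j i) φ)
  have hle : weightSpace ρ ≤
      (fun χ : Circle → ℂ => ⨅ u, (f u).maxGenEigenspace (χ u)) ∘ fun k : ℤ => fun u : Circle =>
        ((u : ℂ) ^ k) := fun k =>
    iInf_mono fun u => eigenspace_le_maxGenEigenspace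
  exact (hind.comp zpow_coe_injective).mono hle

variable [FiniteDimensional ℂ W] [TopologicalSpace W] [IsTopologicalAddGroup W] [ContinuousSMul ℂ W]
  [T2Space W]

/-- **A finite-dimensional continuous representation of `U(1)` is the sum of its integer weight spaces**
(Bröcker–tom Dieck II (8.1) with (1.14)/(8.2), for `S¹`): if `ρ : U(1) → End W` has continuous orbit maps
on a finite-dimensional Hausdorff topological vector space `W`, then `⨆_{k ∈ ℤ} W_k = W`.
[cite: BrockerTomDieck1985, II (8.1)] -/
theorem iSup_weightSpace_eq_top (ρ : Circle →* Module.End ℂ W) (hρ : ∀ x : W, Continuous fun u => ρ u x) :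
    ⨆ k : ℤ, weightSpace ρ k = ⊤ := by
  classical
  -- (A) the torsion of `U(1)` acts by a commuting family of semisimple operators: joint eigenspaces span
  let T := {u : Circle // IsOfFinOrder u}
  let f : T → Module.End ℂ W := fun t => ρ t.1
  have hcomm : Pairwise fun i j => Commute (f i) (f j) := fun i j _ => by
    change ρ i.1 * ρ j.1 = ρ j.1 * ρ i.1
    rw [← map_mul, ← map_mul, mul_comm]
  have hss : ∀ t : T, (f t).IsFinitelySemisimple := fun t => by
    rw [Module.End.isFinitelySemisimple_iff_isSemisimple]
    obtain ⟨n, hn, hn1⟩ := isOfFinOrder_iff_pow_eq_one.mp t.2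
    exact isSemisimple_of_pow_eq_one hn (by rw [← map_pow, hn1, map_one])
  have htop : ⨆ χ : T → ℂ, ⨅ t, eigenspace (f t) (χ t) = ⊤ := by
    have h := Module.End.iSup_iInf_maxGenEigenspace_eq_top_of_iSup_maxGenEigenspace_eq_top_of_commute f
      hcomm fun t => Module.End.iSup_maxGenEigenspace_eq_top (f t)
    have e : ∀ (t : T) (μ : ℂ), (f t).maxGenEigenspace μ = (f t).eigenspace μ := fun t μ =>
      (hss t).maxGenEigenspace_eq_eigenspace μ
    simp_rw [e] at h
    exact h
  -- (B) each joint eigenspace of the torsion lies in an integer weight space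
  rw [eq_top_iff, ← htop]
  refine iSup_le fun χ => fun x hx => ?_
  by_cases hx0 : x = 0
  · rw [hx0]; exact Submodule.zero_mem _
  have hxT : ∀ t : T, ρ t.1 x = χ t • x := fun t =>
    mem_eigenspace_iff.mp ((Submodule.mem_iInf _).mp hx t)
  -- the line through `x` is closed and contains `ρ(u)x` for the dense set of torsion `u`, hence for all `u`
  let L : Submodule ℂ W := ℂ ∙ x
  have hLc : IsClosed (L : Set W) := L.closed_of_finiteDimensional
  have hS : ∀ u : Circle, ρ u x ∈ L := by
    have hcl : IsClosed {u : Circle | ρ u x ∈ L} := hLc.preimage (hρ x)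
    have hsub : {u : Circle | IsOfFinOrder u} ⊆ {u : Circle | ρ u x ∈ L} := fun u hu => by
      simp only [Set.mem_setOf_eq, hxT ⟨u, hu⟩]
      exact L.smul_mem _ (Submodule.mem_span_singleton_self x)
    have huniv : {u : Circle | ρ u x ∈ L} = Set.univ := by
      rw [← hcl.closure_eq]
      exact (dense_isOfFinOrder.mono hsub).closure_eq
    exact fun u => Set.eq_univ_iff_forall.mp huniv u
  -- a linear functional normalised at `x`, and the character `c(u) := ℓ(ρ(u)x)`
  obtain ⟨ℓ, hℓ⟩ := LinearMap.exists_leftInverse_of_injective (LinearMap.toSpanSingleton ℂ W x)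
    (LinearMap.ker_toSpanSingleton ℂ hx0)
  have hℓx : ∀ a : ℂ, ℓ (a • x) = a := fun a => by
    have h := LinearMap.congr_fun hℓ a
    simpa only [LinearMap.comp_apply, LinearMap.toSpanSingleton_apply, LinearMap.id_apply] using h
  have hc : ∀ u : Circle, ρ u x = ℓ (ρ u x) • x := fun u => by
    obtain ⟨a, ha⟩ := Submodule.mem_span_singleton.mp (hS u)
    rw [← ha, hℓx]
  let c : Circle →* ℂ :=
    { toFun := fun u => ℓ (ρ u x)
      map_one' := by
        rw [map_one, Module.End.one_apply]
        simpa only [one_smul] using hℓx 1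
      map_mul' := fun u v => by
        have hv := hc v
        have hu := hc u
        set a := ℓ (ρ v x)
        set b := ℓ (ρ u x)
        rw [map_mul, Module.End.mul_apply, hv, map_smul, hu, smul_smul, hℓx, mul_comm] }
  have hcc : Continuous c := ℓ.continuous_of_finiteDimensional.comp (hρ x)
  obtain ⟨n, hn, -⟩ := CircleChar.existsUnique_zpow_complex c hcc
  refine Submodule.mem_iSup_of_mem n ((mem_weightSpace_iff ρ n x).mpr fun u => ?_)
  rw [hc u]
  exact congrArg (· • x) (hn u)

/-- **`W = ⊕_{k ∈ ℤ} W_k`**: the weight-space decomposition of a finite-dimensional continuous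
`U(1)`-module is an internal direct sum (Bröcker–tom Dieck II (8.2): "every complex `T`-module is the
direct sum of its weight spaces", for `T = S¹`). [cite: BrockerTomDieck1985, II (8.2)] -/
theorem isInternal_weightSpace (ρ : Circle →* Module.End ℂ W) (hρ : ∀ x : W, Continuous fun u => ρ u x) :
    DirectSum.IsInternal (weightSpace ρ) :=
  DirectSum.isInternal_submodule_of_iSupIndep_of_iSup_eq_top (iSupIndep_weightSpace ρ)
    (iSup_weightSpace_eq_top ρ hρ)

omit [TopologicalSpace W] [IsTopologicalAddGroup W] [ContinuousSMul ℂ W] [T2Space W] in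
/-- Only finitely many weight spaces of a finite-dimensional `U(1)`-module are non-zero. [folklore] -/
theorem finite_weightSpace_ne_bot (ρ : Circle →* Module.End ℂ W) : {k : ℤ | weightSpace ρ k ≠ ⊥}.Finite := by
  haveI := (iSupIndep_weightSpace ρ).fintypeNeBotOfFiniteDimensional
  have h : Finite {k : ℤ // weightSpace ρ k ≠ ⊥} := inferInstance
  exact Set.finite_coe_iff.mp h

end CircleWeights

end Literature.RepresentationTheory.CompactGroups

end
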